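import Summits.CriticalPhenomena.PercolationContinuityZ3.Theorems.PercNearOneGluingNoHeavyLowerTailFKAnalogues
import HarnessLib

/-!
# FK sub-lane: the surplus-with-decoys family (S5D) with the MEASURE as a parameter — DEFINITIONS

Definitions file (`--supports stmt-CriticalPhenomena-4575`), FK sub-lane `prim-bschramm-fk-1` (gen 2) of the post-continuity
programme; builds on p205010 (kernel theorem, internal audit signed; external expert review pending).  No named facts, no sorries;
standard axioms.  NOTHING is claimed here for any particular measure: these are the objects of prim-hp-8's peeling theorem
(memo PROOF-S5-ALL-R.md §1.2/§4, tree `CSH.surplus` / `CSH.s5dMargin` / `CSH.s5dMargin_nonneg_of_csh`, all written for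
`prodBernoulli w`) with a general measure `μ` on the bond configurations in place of `prodBernoulli w`, so that the peeling
"CSH under `μ` ⟹ (S5) under `μ`" can be stated and proved ONCE for every fully supported probability measure and then specialised to
the random-cluster measures `φ_{w,q} = rcMeasureW w q ∅` (companion proof files `…FKCSHPeelTools.lean`, `…FKCSHPeel.lean`,
`…FKCSHToAdditiveGluing.lean`).  The level forms `CSH.slForm` / `CSH.cshMarg` are measure-free and reused; the decoy data
`FK.decoyListμ`, `FK.obsConstμ`, `FK.covDμ`, `FK.cshMarginμ`, `FK.CSHHoldsFor` are fk-1 gen 1's (`…FKAnalogues.lean`).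

* `FK.surplusμ μ T r F u` — the ranked surplus `Sur_u(T) = ∫_{u ↔ T} F(C(u)) dμ − Σ_{a ∈ T} μ(P^u_a)·m_a` under `μ` — VERBATIM the bracket
  of the hypothesis `hS5` of fk-2's `FK.additiveGluingUnder_of_surplusTransfer` / `FK.gen_firstRank_of_surplusTransfer_under`
  (`CSH.surplus` with `μ` for `prodBernoulli w`);
* `FK.s5dMarginμ μ T r D o v F` — the (S5D) margin: the level form of the relay set applied to `u ↦ Sur_u(T)` (`CSH.s5dMargin` with `μ`);
* `surplusμ_prodBernoulli`, `s5dMarginμ_prodBernoulli` — at `μ = prodBernoulli w` these ARE the tree's objects (`rfl` up to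
  `FK.decoyListμ_prodBernoulli`);
* `s5dMarginμ_nil`, `hS5_of_s5dMarginμ_nil` — with no decoys the margin is `Sur_o − p·Sur_v`, i.e. (S5) under `μ` after clearing the
  denominator `μ(v ↮ T)`;
* `mem_decoyListμ`, `surplusμ_empty` — bookkeeping.
[cite: KozmaNitzan2024, Conj. 1 (p. 3), Conj. 4 (p. 32)] [cite: VandenbergHaggstromKahn2005, Thm. 1.3 (p. 6)]
[cite: Grimmett2006, §1.4 eq. (1.20) (p. 15)]
-/

noncomputable section

namespace Summit.CriticalPhenomena.PercolationContinuityZ3.Theorems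

open MeasureTheory Set Literature.Probability.LatticeModels Literature.Probability.Percolation
open scoped Classical

namespace FK

variable {V : Type*}

/-- **The ranked surplus under a general measure `μ`**: `Sur_u(T) = ∫_{u ↔ T} F(C(u)) dμ − Σ_{a ∈ T} μ(P^u_a)·m_a` with the first-in-rank
patterns `P^u_a = {u ↔ a} ∩ ⋂_{r a' < r a} {u ↮ a'}` and means `m_a = ∫ F(C(a)) dμ` (`CSH.surplus` with `μ` for `prodBernoulli w`;
verbatim the bracket of fk-2's `hS5`). (transcription of the cell memo prim-hp-8 PROOF-S5-ALL-R.md §1.2, measure-parametrised)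
[cite: KozmaNitzan2024, Conj. 4 (p. 32)] -/
def surplusμ (μ : Measure (BondConfig V)) (T : Finset V) (r : V → ℕ) (F : Set V → ℝ) (u : V) : ℝ :=
  (∫ ω in (⋃ a ∈ T, openConn u a), F (openCluster ω u) ∂μ) -
    ∑ a ∈ T, μ.real (openConn u a ∩ ⋂ a' ∈ T.filter (fun a' => r a' < r a), (openConn u a')ᶜ : Set (BondConfig V)) *
      ∫ ω, F (openCluster ω a) ∂μ

/-- **The (S5D) margin under a general measure `μ`**: the level form of the relay set `T` with decoys `D` (constants conditioned on
avoiding `T` and the earlier decoys, observers' constant on avoiding `T ∪ D`) applied to `u ↦ Sur_u(T)` (`CSH.s5dMargin` with `μ` for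
`prodBernoulli w`). (transcription of the cell memo prim-hp-8 PROOF-S5-ALL-R.md §1.2, measure-parametrised) [cite: KozmaNitzan2024, Conj. 4 (p. 32)] -/
def s5dMarginμ (μ : Measure (BondConfig V)) (T : Finset V) (r : V → ℕ) (D : List V) (o v : V) (F : Set V → ℝ) : ℝ :=
  CSH.cshMarg (decoyListμ μ (↑T : Set V) D) (obsConstμ μ o v ((↑T : Set V) ∪ {d | d ∈ D})) o v (surplusμ μ T r F)

/-- At `μ = prodBernoulli w` the ranked surplus is the tree's `CSH.surplus`. [folklore] -/
@[simp] theorem surplusμ_prodBernoulli (w : Sym2 V → unitInterval) (T : Finset V) (r : V → ℕ) (F : Set V → ℝ) :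
    surplusμ (prodBernoulli w) T r F = CSH.surplus w T r F := rfl

/-- At `μ = prodBernoulli w` the observers' constant is the tree's `CSH.obsConst`. [folklore] -/
@[simp] theorem obsConstμ_prodBernoulli (w : Sym2 V → unitInterval) (o v : V) (A : Set V) :
    obsConstμ (prodBernoulli w) o v A = CSH.obsConst w o v A := rfl

/-- At `μ = prodBernoulli w` the (S5D) margin is the tree's `CSH.s5dMargin`. [folklore] -/
@[simp] theorem s5dMarginμ_prodBernoulli (w : Sym2 V → unitInterval) (T : Finset V) (r : V → ℕ) (D : List V) (o v : V)
    (F : Set V → ℝ) : s5dMarginμ (prodBernoulli w) T r D o v F = CSH.s5dMargin w T r D o v F := by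
  unfold s5dMarginμ CSH.s5dMargin
  rw [decoyListμ_prodBernoulli, obsConstμ_prodBernoulli, surplusμ_prodBernoulli]

/-- The decoys of `decoyListμ μ A D` are the members of `D`. [folklore] -/
theorem mem_decoyListμ (μ : Measure (BondConfig V)) :
    ∀ (A : Set V) (D : List V) (dc : V × (V → ℝ)), dc ∈ decoyListμ μ A D → dc.1 ∈ D
  | _, [], dc, h => by simp [decoyListμ] at h
  | A, d :: D, dc, h => by
    simp only [decoyListμ, List.mem_cons] at h
    rcases h with rfl | h
    · exact List.mem_cons_self
    · exact List.mem_cons_of_mem _ (mem_decoyListμ μ (insert d A) D dc h)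

/-- With no relays the surplus vanishes identically. [folklore] -/
@[simp] theorem surplusμ_empty (μ : Measure (BondConfig V)) (r : V → ℕ) (F : Set V → ℝ) :
    surplusμ μ (∅ : Finset V) r F = fun _ => 0 := by
  funext u; simp [surplusμ]

/-- With no decoys the (S5D) margin is `Sur_o(T) − p · Sur_v(T)`, `p = μ(o ↔ v, v ↮ T)/μ(v ↮ T)` — the surplus-transfer inequality
(S5) under `μ` after clearing the denominator. (transcription of the cell memo prim-hp-8 PROOF-S5-ALL-R.md §1.2, measure-parametrised) [folklore] -/
theorem s5dMarginμ_nil (μ : Measure (BondConfig V)) (T : Finset V) (r : V → ℕ) (o v : V) (F : Set V → ℝ) :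
    s5dMarginμ μ T r [] o v F =
      surplusμ μ T r F o -
        μ.real ({ω : BondConfig V | ∀ a ∈ (↑T : Set V), ¬ (openGraph ω).Reachable v a} ∩ openConn o v) /
            μ.real {ω : BondConfig V | ∀ a ∈ (↑T : Set V), ¬ (openGraph ω).Reachable v a} *
          surplusμ μ T r F v := by
  simp only [s5dMarginμ, decoyListμ, CSH.cshMarg_nil, obsConstμ, List.not_mem_nil, setOf_false, union_empty]

/-- **(S5) under `μ` from the decoy-free (S5D) margin**: if `μ(v ↮ T) > 0` and `s5dMarginμ μ T r [] o v F ≥ 0` then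
`μ(v ↮ T, o ↔ v) · Sur_v(T) ≤ μ(v ↮ T) · Sur_o(T)` — the shape of fk-2's hypothesis `hS5`.
(transcription of the cell memo prim-hp-8 PROOF-S5-ALL-R.md §1.2, measure-parametrised) [folklore] -/
theorem hS5_of_s5dMarginμ_nil (μ : Measure (BondConfig V)) (T : Finset V) (r : V → ℕ) (o v : V) (F : Set V → ℝ)
    (hpos : 0 < μ.real {ω : BondConfig V | ∀ a ∈ (↑T : Set V), ¬ (openGraph ω).Reachable v a})
    (h : 0 ≤ s5dMarginμ μ T r [] o v F) :
    μ.real ({ω : BondConfig V | ∀ a ∈ (↑T : Set V), ¬ (openGraph ω).Reachable v a} ∩ openConn o v) * surplusμ μ T r F v ≤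
      μ.real {ω : BondConfig V | ∀ a ∈ (↑T : Set V), ¬ (openGraph ω).Reachable v a} * surplusμ μ T r F o := by
  rw [s5dMarginμ_nil] at h
  set M := μ.real {ω : BondConfig V | ∀ a ∈ (↑T : Set V), ¬ (openGraph ω).Reachable v a} with hM
  set E := μ.real ({ω : BondConfig V | ∀ a ∈ (↑T : Set V), ¬ (openGraph ω).Reachable v a} ∩ openConn o v) with hE
  have h2 : 0 ≤ M * (surplusμ μ T r F o - E / M * surplusμ μ T r F v) := mul_nonneg hpos.le h
  have h3 : M * (surplusμ μ T r F o - E / M * surplusμ μ T r F v) = M * surplusμ μ T r F o - E * surplusμ μ T r F v := by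
    field_simp
  linarith [h2, h3]

end FK

end Summit.CriticalPhenomena.PercolationContinuityZ3.Theorems

end
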